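import Summits.BirchSwinnertonDyer.BirchSwinnertonDyer.Theses.DerivedKatoValuationDoor
import Summits.BirchSwinnertonDyer.BirchSwinnertonDyer.Theorems.DerivedKatoValuationDoorDerivedKatoDoorStubDepthLeQuotientLength
import Summits.BirchSwinnertonDyer.BirchSwinnertonDyer.Theorems.DerivedKatoValuationDoorDerivedKatoDoorStubQuotientLengthLeFineLength
import HarnessLib

/-!
# Split glue for the deciding crux `DerivedKatoDoor` (route `DerivedKatoValuationDoor`, stmt-BirchSwinnertonDyer-23024)

`KatoMainConjecturePrimeTOfDoor → FineLengthLeOneOfAnalyticRankTwo → DerivedKatoDoor`, over the route's OWN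
decls (items stmt-BirchSwinnertonDyer-23168 = print named fact by name, stmt-BirchSwinnertonDyer-23167 = the
LEAD's promoted stub L3 of line `lower`), sorry-free over LANDED theorems only:
`Theorems.stub_depthLeQuotientLength` (p656388: `p^m z₀ = T^k h`, `z₀ ≠ 0` ⇒ `k ≤ ℓ_T(𝐇¹/Λz₀)`) and
`Theorems.DerivedKatoValuationDoor.stub_quotientLengthLeFineLength_of_fact` (w2: under the fact,
`z₀ ≠ 0 ∧ ℓ_T(𝐇¹/Λz₀) ≤ ℓ_T(X₀)`). The composition is the LEAD's `DerivedKatoDoor_of` of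
`Cruxes/DerivedKatoDoor/Lines/lower.lean` r6 with the two open stubs as hypotheses: `2 ≤ ℓ_T(𝐇¹/Λz₀) ≤ ℓ_T(X₀) ≤ 1`
in `ℕ∞` is absurd. Drafted by the tenure planner (plancard-bsd-s0-dkdoor g2) for
`ledger route edit route-BirchSwinnertonDyer-DerivedKatoValuationDoor --split DerivedKatoDoor --into children.json --glue-by
Summit.BirchSwinnertonDyer.BirchSwinnertonDyer.Theorems.DerivedKatoValuationDoor.derivedKatoDoor_of_subs` once landed
(`ledger propose --kind proof --target Summits/BirchSwinnertonDyer/BirchSwinnertonDyer/Theorems/DerivedKatoValuationDoorDerivedKatoDoorSplit.lean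
--supports stmt-BirchSwinnertonDyer-23024`). BSD is not proved by any of this.
[cite: Kato2004Asterisque, Conj. 12.10 (p. 224), Thm. 12.4 (2) (p. 221)] [cite: BurungaleCastellaSkinner2025, Thm. 1.1.2 (a)]
-/

namespace Summit.BirchSwinnertonDyer.BirchSwinnertonDyer.Theorems.DerivedKatoValuationDoor

open Summit.BirchSwinnertonDyer.BirchSwinnertonDyer.Theses.DerivedKatoValuationDoor
  (DerivedKatoDoor FineLengthLeOneOfAnalyticRankTwo KatoMainConjecturePrimeTOfDoor)

/-- **Split glue `DerivedKatoDoor ⇐ KatoMainConjecturePrimeTOfDoor ∧ FineLengthLeOneOfAnalyticRankTwo`.**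
At a door prime of an analytic-rank-two globally minimal curve, a rational `T²`-divisibility `p^m z₀ = T² h` of an
admissible Kato zeta class would give `2 ≤ ℓ_T(𝐇¹/Λz₀)` (landed depth lemma, `z₀ ≠ 0`), `≤ ℓ_T(X₀(E/ℚ_∞))`
(Kato Conj. 12.10 at `(T)` at door primes — the print fact, item 23168), `≤ 1` (the promoted stub, item 23167):
absurd in `ℕ∞`. [cite: Kato2004Asterisque, Conj. 12.10 (p. 224)] [cite: BurnsKuriharaSano2019, Lemma 6.12] -/
theorem derivedKatoDoor_of_subs
    (hIMC : KatoMainConjecturePrimeTOfDoor) (hFine : FineLengthLeOneOfAnalyticRankTwo) :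
    DerivedKatoDoor := by
  intro W _ _ p _ _ ha hdoor K hK γ I z₀ hγ hz hdiv
  obtain ⟨hne, hle⟩ := stub_quotientLengthLeFineLength_of_fact hIMC W p hdoor K hK γ I z₀ hγ hz
  have h2 :=
    Summit.BirchSwinnertonDyer.BirchSwinnertonDyer.Theorems.stub_depthLeQuotientLength W p K γ I z₀ hγ hne 2 hdiv
  have h1 := hFine W p ha hdoor K hK γ hγ
  have h21 : ((2 : ℕ) : ℕ∞) ≤ 1 := h2.trans (hle.trans h1)
  exact absurd (by exact_mod_cast h21 : (2 : ℕ) ≤ 1) (by omega)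

end Summit.BirchSwinnertonDyer.BirchSwinnertonDyer.Theorems.DerivedKatoValuationDoor
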